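import Summits.RiemannHypothesis.RiemannHypothesis.Theorems.NymanBeurlingKappaKernelRun
import Summits.RiemannHypothesis.RiemannHypothesis.Theorems.NymanBeurlingQDigits
import Summits.RiemannHypothesis.RiemannHypothesis.Theorems.NymanBeurlingDilateZeroSumBound
import HarnessLib

/-!
# RiemannHypothesis / Nyman–Beurling — `κ_∞ = nbKappaPredicted` TO THREE DECIMALS in the kernel:
# `|κ_∞ − 0.3398| ≤ 0.0003` (theory (L5′) `NbKappaLawSharp`, first conjunct; RH-FREE, kernel-certified)

Column LI/NB, rung L-P(P2) «structure of the NB minimiser», PROOF-OF-DATA for cell `pub/rh-li` [rh-li-eng-3 g5].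
The κ-LAW of the NB minimiser (theory/NBHeadTail.lean (T4)/(L5)): `κ_N = tailConst(c⋆_N)/d_N²` is measured `0.3412 ± 0.0005`
at every certified `20 ≤ N ≤ 2000`; the bilinear-BDBLS heuristic predicts the limit
`κ_∞ = [m_1 + Σ_{n≥2}(m_n − m_{n−1}) S(n)/S(1)]/(1+Q)`, which T7 (`NymanBeurlingDilateZeroSumExplicit.lean`) made a PRIME-SIDE
number (`nbKappaPredicted`, `S(n) = nbDilatePrimeSide n`).  Theory typed `|nbKappaPredicted − 0.3398| ≤ 0.0003` (float
`0.33981`).  This file certifies it: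

* head `n = 2..1000`: the kernel pass of parts I/II (`KappaCert.run 999`, `run_sound`, `kappaCheck_eq`) encloses
  `X = Σ_{n=2}^{1000} (m_n − m_{n−1}) S(n)` (von Mangoldt's `Λ` and Möbius-free prime sums evaluated with the tree's interval
  logarithm `KernelLog.logIv`, scale `2⁸⁰`);
* tail `n > 1000`: `|S(n)| < 0.0463` for all `n ≥ 2` (`abs_nbDilatePrimeSide_lt`, Ford's `Σ m/|ρ|² < 0.0462`), the weights
  `m_n − m_{n−1} ≥ 0` (`nbFareyMean_mono`) telescope (`hasSum_fareyIncrements`: `Σ_{n>K}(m_n − m_{n−1}) = ½ − m_K`) and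
  `½ − m_{1000} ≤ (r/3)/(1 − r²)`, `r = 1/2001` (`nbFareyMean_bounds`);
* `β = S(1) = 2 + γ − log 4π` by the 16/20-decimal enclosures of `γ`, `log 2`, `log π`; `Q` to nine decimals (`nbQ_mem_Icc`).

Results: **`abs_nbKappaPredicted_sub_le : |nbKappaPredicted − 0.3398| ≤ 0.0003`**, `nbKappaPredicted_mem_Icc`
(`κ_∞ ∈ [0.3395, 0.3401]`; certified DATA `κ_2000 = 0.3411` — the remaining conjuncts of `NbKappaLawSharp`, `κ_N ↓ κ_∞`, are
limit laws and stay CONJECTURAL).  RH-FREE [rh-li-eng-3 g5]: certified numerics of a prime-side series; nothing here bears on the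
truth of RH.
-/

noncomputable section

set_option linter.dupNamespace false

open Filter Set Finset
open scoped Real

namespace Summit.RiemannHypothesis.RiemannHypothesis.Theorems.NbTheory

open Literature.NumberTheory.LFunctions Literature.Analysis.SpecialFunctions.KernelLog

open KappaCert

/-! ## The bracket for `κ_∞ = nbKappaPredicted` -/

/-- Telescoping of the Farey-mean increments: `Σ_{n≥0} (m_{n+k+2} − m_{n+k+1}) = ½ − m_{k+1}` (non-negative terms). -/
theorem hasSum_fareyIncrements (k : ℕ) :
    HasSum (fun n : ℕ ↦ nbFareyMean (n + k + 2) - nbFareyMean (n + k + 1)) (1 / 2 - nbFareyMean (k + 1)) := by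
  have hpart : ∀ J : ℕ, ∑ n ∈ Finset.range J, (nbFareyMean (n + k + 2) - nbFareyMean (n + k + 1)) =
      nbFareyMean (J + k + 1) - nbFareyMean (k + 1) := by
    intro J
    induction J with
    | zero => simp
    | succ J ih =>
      rw [Finset.sum_range_succ, ih, show J + 1 + k + 1 = J + k + 2 by ring]
      ring
  refine (hasSum_iff_tendsto_nat_of_nonneg (fun n ↦ ?_) _).2 ?_
  · have := nbFareyMean_mono (show n + k + 1 ≤ n + k + 2 by omega); linarith
  · have h := (tendsto_nbFareyMean.comp (tendsto_add_atTop_nat (k + 1))).sub_const (nbFareyMean (k + 1))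
    refine h.congr fun J ↦ ?_
    simp only [Function.comp_apply, hpart]
    rw [show J + (k + 1) = J + k + 1 from (Nat.add_assoc J k 1).symm]

set_option maxHeartbeats 400000 in
/-- **`κ_∞` IN THE KERNEL (RH-FREE): `|nbKappaPredicted − 0.3398| ≤ 0.0003`** — the first conjunct of theory's (L5′)
`NbKappaLawSharp`: the bilinear-BDBLS prediction for the limit of `κ_N = tailConst(c⋆_N)/d_N²` is a certified number
(`nbKappaPredicted ∈ [0.3395, 0.3401]`; certified DATA: `κ_2000 = 0.3411`). -/
theorem abs_nbKappaPredicted_sub_le : |nbKappaPredicted - 0.3398| ≤ 0.0003 := by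
  -- kernel facts
  have hchk := KappaCert.kappaCheck_eq
  unfold KappaCert.kappaCheck at hchk
  cases hr : KappaCert.run 999 with
  | none => simp only [hr] at hchk; simp at hchk
  | some s =>
    obtain ⟨a1, a2, p1, p2, m1, m2, xl, xh⟩ := s
    simp only [hr, Bool.and_eq_true, decide_eq_true_eq] at hchk
    obtain ⟨⟨⟨hxl0, hxh0⟩, hlo⟩, hhi⟩ := hchk
    obtain ⟨-, -, -, ⟨hX1, hX2⟩⟩ := KappaCert.run_sound 999 hr
    have hloR := (Rat.cast_le (K := ℝ)).2 hlo
    have hhiR := (Rat.cast_le (K := ℝ)).2 hhi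
    have hxl0R : (xl : ℝ) ≤ 0 := by exact_mod_cast hxl0
    have hxh0R : (xh : ℝ) ≤ 0 := by exact_mod_cast hxh0
    push_cast [KappaCert.M1LO, KappaCert.M1HI, KappaCert.BLO, KappaCert.BHI, KappaCert.TMAX] at hloR hhiR
    clear hlo hhi hr hxl0 hxh0
    -- the real constants
    have hglo := Literature.Analysis.SpecialFunctions.Real.eulerMascheroniConstant_gt_d16
    have hghi := Literature.Analysis.SpecialFunctions.Real.eulerMascheroniConstant_lt_d16
    have hl2lo := Literature.Analysis.SpecialFunctions.Real.log_two_gt_d20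
    have hl2hi := Literature.Analysis.SpecialFunctions.Real.log_two_lt_d20
    have hlpilo := Literature.Analysis.SpecialFunctions.Real.log_pi_gt_d20
    have hlpihi := Literature.Analysis.SpecialFunctions.Real.log_pi_lt_d20
    obtain ⟨hQlo, hQhi⟩ := nbQ_mem_Icc
    set β := 2 + Real.eulerMascheroniConstant - Real.log (4 * Real.pi) with hβdef
    have hβ : β = 2 + Real.eulerMascheroniConstant - 2 * Real.log 2 - Real.log Real.pi := by
      rw [hβdef, show (4 : ℝ) * Real.pi = 2 ^ 2 * Real.pi by norm_num,
        Real.log_mul (by positivity) Real.pi_pos.ne', Real.log_pow]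
      push_cast; ring
    set BLOr : ℝ := 2 + 0.5772156649015328 - 2 * 0.69314718055994530944 - 1.14472988584940017415 with hBLOr
    set BHIr : ℝ := 2 + 0.5772156649015405 - 2 * 0.69314718055994530940 - 1.14472988584940017414 with hBHIr
    have hβlo : BLOr ≤ β := by rw [hβ, hBLOr]; linarith
    have hβhi : β ≤ BHIr := by rw [hβ, hBHIr]; linarith
    have hBLO0 : 0 < BLOr := by rw [hBLOr]; norm_num
    have hβ0 : 0 < β := lt_of_lt_of_le hBLO0 hβlo
    have hm1 : nbFareyMean 1 = 2 * Real.log 2 - 1 := by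
      rw [FareyMean.nbFareyMean_of_pos one_pos]; norm_num
    -- the series of `nbKappaPredicted`
    set g : ℕ → ℝ := fun n ↦ (nbFareyMean (n + 2) - nbFareyMean (n + 1)) * (nbDilatePrimeSide (n + 2) / β) with hg
    have hκ : nbKappaPredicted = (nbFareyMean 1 + ∑' n, g n) / (1 + nbQ) := rfl
    have hw0 : ∀ n : ℕ, 0 ≤ nbFareyMean (n + 2) - nbFareyMean (n + 1) := fun n ↦ by
      have := nbFareyMean_mono (show n + 1 ≤ n + 2 by omega); linarith
    have hPbd : ∀ n : ℕ, |nbDilatePrimeSide (n + 2)| ≤ 0.0463 := fun n ↦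
      (abs_nbDilatePrimeSide_lt (by omega : 2 ≤ n + 2)).le
    have hgbd : ∀ n : ℕ, ‖g n‖ ≤ (nbFareyMean (n + 2) - nbFareyMean (n + 1)) * (0.0463 / β) := by
      intro n
      rw [hg, Real.norm_eq_abs, abs_mul, abs_of_nonneg (hw0 n), abs_div, abs_of_pos hβ0]
      exact mul_le_mul_of_nonneg_left (div_le_div_of_nonneg_right (hPbd n) hβ0.le) (hw0 n)
    have hW := hasSum_fareyIncrements 0
    simp only [add_zero] at hW
    have hgs : Summable g := Summable.of_norm_bounded (hW.summable.mul_right (0.0463 / β)) hgbd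
    -- split at `K = 999`
    have hsplit := (hgs.sum_add_tsum_nat_add 999).symm
    -- the head is `X/β`
    set X := ∑ j ∈ Finset.Ico 2 (999 + 2), (nbFareyMean j - nbFareyMean (j - 1)) * nbDilatePrimeSide j with hXdef
    have hhead : ∑ n ∈ Finset.range 999, g n = X / β := by
      rw [hXdef, Finset.sum_Ico_eq_sum_range, Finset.sum_div]
      refine Finset.sum_congr (by norm_num) fun n _ ↦ ?_
      rw [hg]
      simp only [show 2 + n = n + 2 by ring, show n + 2 - 1 = n + 1 by omega]
      ring
    -- the tail
    have hWt := hasSum_fareyIncrements 999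
    have htail : ‖∑' n, g (n + 999)‖ ≤ (1 / 2 - nbFareyMean (999 + 1)) * (0.0463 / β) := by
      refine tsum_of_norm_bounded (hWt.mul_right (0.0463 / β)) fun n ↦ ?_
      have := hgbd (n + 999)
      convert this using 2
    have hU := (nbFareyMean_bounds (show 0 < 1000 by norm_num)).2
    have hU' : 1 / 2 - nbFareyMean (999 + 1) ≤ 1 / (2 * (1000 : ℝ) + 1) / 3 / (1 - (1 / (2 * (1000 : ℝ) + 1)) ^ 2) := by
      have e : (999 + 1 : ℕ) = 1000 := rfl
      rw [e]; exact_mod_cast hU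
    -- numeric tail allowance
    have hTle : (1 / 2 - nbFareyMean (999 + 1)) * (0.0463 / β) ≤
        (1 / (2 * (1000 : ℝ) + 1) / 3 / (1 - (1 / (2 * (1000 : ℝ) + 1)) ^ 2)) * (0.0463 / BLOr) := by
      have h1 : 0.0463 / β ≤ 0.0463 / BLOr := div_le_div_of_nonneg_left (by norm_num) hBLO0 hβlo
      have h2 : 0 ≤ 1 / 2 - nbFareyMean (999 + 1) := by linarith [nbFareyMean_lt_half (999 + 1)]
      have h3 : (0 : ℝ) ≤ 1 / (2 * (1000 : ℝ) + 1) / 3 / (1 - (1 / (2 * (1000 : ℝ) + 1)) ^ 2) := by norm_num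
      exact mul_le_mul hU' h1 (by positivity) h3
    rw [Real.norm_eq_abs] at htail
    obtain ⟨hT1, hT2⟩ := abs_le.1 (htail.trans hTle)
    -- `X/β` against the kernel integers
    have hS : (0 : ℝ) < (2 : ℝ) ^ 80 := by positivity
    have hBHI0 : 0 < BHIr := lt_of_lt_of_le hβ0 hβhi
    have hXβlo : (xl : ℝ) / (2 ^ 80 * BLOr) ≤ X / β := by
      have h1 : (xl : ℝ) / 2 ^ 80 / β ≤ X / β := div_le_div_of_nonneg_right hX1 hβ0.le
      have h2 : (xl : ℝ) / (2 ^ 80 * BLOr) ≤ (xl : ℝ) / 2 ^ 80 / β := by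
        rw [div_div, div_le_div_iff₀ (by positivity) (by positivity)]
        nlinarith [hxl0R, hβlo, hS]
      linarith
    have hXβhi : X / β ≤ (xh : ℝ) / (2 ^ 80 * BHIr) := by
      have h1 : X / β ≤ (xh : ℝ) / 2 ^ 80 / β := div_le_div_of_nonneg_right hX2 hβ0.le
      have h2 : (xh : ℝ) / 2 ^ 80 / β ≤ (xh : ℝ) / (2 ^ 80 * BHIr) := by
        rw [div_div, div_le_div_iff₀ (by positivity) (by positivity)]
        nlinarith [hxh0R, hβhi, hS]
      linarith
    -- kernel inequalities divided through
    have hkl : (0.3395 : ℝ) * (1 + 0.0803270405) ≤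
        (2 * 0.69314718055994530940 - 1) -
          0.0463 / BLOr * ((1 : ℝ) / 2001 / 3 / (1 - (1 / 2001) ^ 2)) + (xl : ℝ) / (2 ^ 80 * BLOr) := by
      have hden : 0 < (2 : ℝ) ^ 80 * BLOr := by positivity
      have e : (2 * 0.69314718055994530940 - 1) -
          0.0463 / BLOr * ((1 : ℝ) / 2001 / 3 / (1 - (1 / 2001) ^ 2)) + (xl : ℝ) / (2 ^ 80 * BLOr) =
          (((2 * 0.69314718055994530940 - 1) - 0.0463 / BLOr * ((1 : ℝ) / 2001 / 3 / (1 - (1 / 2001) ^ 2))) *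
            (2 ^ 80 * BLOr) + (xl : ℝ)) / (2 ^ 80 * BLOr) := by
        field_simp
      rw [e, le_div_iff₀ hden, hBLOr]
      rw [hBLOr] at hloR
      linarith only [hloR]
    have hku : (2 * 0.69314718055994530944 - 1) +
          0.0463 / BLOr * ((1 : ℝ) / 2001 / 3 / (1 - (1 / 2001) ^ 2)) + (xh : ℝ) / (2 ^ 80 * BHIr) ≤
        (0.3401 : ℝ) * (1 + 0.0803270385) := by
      have hden : 0 < (2 : ℝ) ^ 80 * BHIr := by positivity
      have e : (2 * 0.69314718055994530944 - 1) +
          0.0463 / BLOr * ((1 : ℝ) / 2001 / 3 / (1 - (1 / 2001) ^ 2)) + (xh : ℝ) / (2 ^ 80 * BHIr) =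
          (((2 * 0.69314718055994530944 - 1) + 0.0463 / BLOr * ((1 : ℝ) / 2001 / 3 / (1 - (1 / 2001) ^ 2))) *
            (2 ^ 80 * BHIr) + (xh : ℝ)) / (2 ^ 80 * BHIr) := by
        field_simp
      rw [e, div_le_iff₀ hden, hBLOr, hBHIr]
      rw [hBLOr, hBHIr] at hhiR
      linarith only [hhiR]
    clear hloR hhiR
    have hm1lo : 2 * 0.69314718055994530940 - 1 ≤ nbFareyMean 1 := by rw [hm1]; linarith only [hl2lo]
    have hm1hi : nbFareyMean 1 ≤ 2 * 0.69314718055994530944 - 1 := by rw [hm1]; linarith only [hl2hi]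
    have hUeq : 1 / (2 * (1000 : ℝ) + 1) / 3 / (1 - (1 / (2 * (1000 : ℝ) + 1)) ^ 2) =
        (1 : ℝ) / 2001 / 3 / (1 - (1 / 2001) ^ 2) := by norm_num
    rw [hUeq] at hT1 hT2
    -- assemble
    have hQ0 : 0 < 1 + nbQ := by linarith only [hQlo]
    rw [hκ, hsplit, hhead, abs_le]
    constructor
    · have hq : (0.3395 : ℝ) * (1 + nbQ) ≤ 0.3395 * (1 + 0.0803270405) :=
        mul_le_mul_of_nonneg_left (by linarith only [hQhi]) (by norm_num)
      have hnum : 0.3395 * (1 + nbQ) ≤ nbFareyMean 1 + (X / β + ∑' n, g (n + 999)) := by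
        linarith only [hq, hkl, hm1lo, hXβlo, hT1]
      have hgoal : (0.3398 - 0.0003 : ℝ) * (1 + nbQ) ≤ nbFareyMean 1 + (X / β + ∑' n, g (n + 999)) := by
        have e : (0.3398 - 0.0003 : ℝ) = 0.3395 := by norm_num
        rw [e]; exact hnum
      rw [le_sub_iff_add_le, le_div_iff₀ hQ0]
      linarith only [hgoal]
    · have hq : (0.3401 : ℝ) * (1 + 0.0803270385) ≤ 0.3401 * (1 + nbQ) :=
        mul_le_mul_of_nonneg_left (by linarith only [hQlo]) (by norm_num)
      have hnum : nbFareyMean 1 + (X / β + ∑' n, g (n + 999)) ≤ 0.3401 * (1 + nbQ) := by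
        linarith only [hq, hku, hm1hi, hXβhi, hT2]
      have hgoal : nbFareyMean 1 + (X / β + ∑' n, g (n + 999)) ≤ (0.0003 + 0.3398 : ℝ) * (1 + nbQ) := by
        have e : (0.0003 + 0.3398 : ℝ) = 0.3401 := by norm_num
        rw [e]; exact hnum
      rw [sub_le_iff_le_add, div_le_iff₀ hQ0]
      linarith only [hgoal]

/-- **Theory's `NbKappaLawSharp`, first conjunct (RH-FREE, DISCHARGED):** `|κ_∞ − 0.3398| ≤ 0.0003` for the prime-side
prediction `κ_∞ = nbKappaPredicted`; the other two conjuncts (`κ_N ∈ [0.3398, 0.3412]` for `N ≥ 2000`, `κ_N → κ_∞`) are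
limit laws about the minimiser and stay CONJECTURAL (beyond RH). -/
theorem nbKappaPredicted_mem_Icc : (0.3395 : ℝ) ≤ nbKappaPredicted ∧ nbKappaPredicted ≤ 0.3401 := by
  have h := abs_nbKappaPredicted_sub_le
  rw [abs_le] at h
  constructor
  · norm_num at h ⊢; linarith [h.1]
  · norm_num at h ⊢; linarith [h.2]

end Summit.RiemannHypothesis.RiemannHypothesis.Theorems.NbTheory

end
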